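import Literature.InformationTheory.QuantumCodes.ToricCodeLossErrorPhaseBoundary
import Literature.InformationTheory.QuantumCodes.ToricCodeDuality
import HarnessLib

/-!
# Toric code under losses AND errors, V: the `X` sector by lattice self-duality

Topic `Literature/InformationTheory/QuantumCodes` (venture QEC, LADDER-QEC rung Q5; qec-type-03). All PROVED, no named fact,
kernel axioms. The loss–error phase boundary `0 < p_c(y) ↔ y < 1/2` of `ToricCodeLossErrorPhaseBoundary.lean` is stated for
`Z`-errors (checks `starMatrix`, trivial errors `boundaries`). The square lattice on the torus is self-dual
(`ToricCodeDuality.lean`: `dualEdge`, `dualChain`, `plaquetteMatrix_mulVec`, `dualChain_mem_boundaries_iff`), so the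
`X`-sector problem (bit flips detected by the plaquettes `plaquetteMatrix`, trivial errors `rowSpace starMatrix`) with
heralded losses IS a `Z`-sector problem: this file conjugates ERASURE-AWARE decoders (`dualErasureDecoder`: dualise the
loss pattern by `dualEdge`, read the syndrome antipodally, dualise the answer), shows that minimum weight outside the losses
is preserved (`isMinWeightOutside_dualErasureDecoder`), and that the mixed-channel failure probability is INVARIANT
(`mixedFailureProb_dual`). Consequences: the `X`-sector phase boundary `xMixed_accuracyThreshold_pos_iff` and exponential
decay below it, for every family of minimum-weight-outside-the-losses `X`-decoders.

## References

* [DennisEtAl2002] Dennis–Kitaev–Landahl–Preskill, J. Math. Phys. 43 (2002) 4452, §3.1 (the dual lattice), §4.1 ("we may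
  treat X errors and Z errors separately" — identically, by duality).
* [StaceBarrettDoherty2009] T. M. Stace, S. D. Barrett, A. C. Doherty, PRL 102 (2009) 200501, p. 2 (losses affect both
  kinds of logical operators alike; the phase diagram).
-/

noncomputable section

namespace Literature.InformationTheory.QuantumCodes

namespace ToricCode

open Finset Matrix Filter Topology

variable {L : ℕ}

/-! ### Dual loss patterns and supports -/

/-- The support of the dual chain is the dual image of the support. [cite: DennisEtAl2002, §3.1 (duality is a bijection of links)] -/
theorem supp_dualChain [NeZero L] (x : Chain L) : supp (dualChain x) = (supp x).map (dualEdge L).toEmbedding := by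
  ext ℓ
  simp only [supp, mem_filter, mem_univ, true_and, Finset.mem_map_equiv, dualChain]
  constructor
  · intro h
    have : (dualEdge L).symm ℓ = dualEdge L ℓ := by
      rw [Equiv.symm_apply_eq]; exact (dualEdge_apply_dualEdge ℓ).symm
    rwa [this]
  · intro h
    have : (dualEdge L).symm ℓ = dualEdge L ℓ := by
      rw [Equiv.symm_apply_eq]; exact (dualEdge_apply_dualEdge ℓ).symm
    rwa [this] at h

/-- Dualising a loss pattern twice gives it back. [cite: DennisEtAl2002, §3.1] -/
@[simp] theorem map_dualEdge_map_dualEdge (Er : Finset (Edge L)) :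
    (Er.map (dualEdge L).toEmbedding).map (dualEdge L).toEmbedding = Er := by
  ext ℓ
  simp only [Finset.mem_map_equiv]
  have : (dualEdge L).symm ((dualEdge L).symm ℓ) = ℓ := by
    rw [Equiv.symm_apply_eq, Equiv.symm_apply_eq]; exact (dualEdge_apply_dualEdge ℓ).symm
  rw [this]

/-- The non-lost part of a support, dualised: `supp x^* ∖ Er^* = (supp x ∖ Er)^*`. [cite: DennisEtAl2002, §3.1] -/
theorem supp_dualChain_sdiff [NeZero L] (x : Chain L) (Er : Finset (Edge L)) :
    supp (dualChain x) \ Er.map (dualEdge L).toEmbedding = (supp x \ Er).map (dualEdge L).toEmbedding := by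
  rw [supp_dualChain, Finset.map_sdiff]

/-! ### Conjugating erasure-aware decoders -/

/-- **The `Z`-decoder (with losses) conjugate to an `X`-decoder** `DX`: dualise the loss pattern, read the star syndrome at
the antipodal plaquettes, decode with `DX`, dualise the correction.
[cite: DennisEtAl2002, §4.1 (X errors are decoded exactly as Z errors, on the dual lattice)] -/
def dualErasureDecoder (DX : ErasureDecoder (Edge L) (Vertex L → ZMod 2)) : ErasureDecoder (Edge L) (Syndrome L) :=
  fun Er σ => dualChain (DX (Er.map (dualEdge L).toEmbedding) fun w => σ (-w))

/-- The star syndrome of a dual chain, read antipodally, is the plaquette syndrome. [cite: DennisEtAl2002, §3.1] -/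
theorem starMatrix_mulVec_dualChain_neg [NeZero L] (x : Chain L) :
    (fun w => (starMatrix L *ᵥ dualChain x) (-w)) = plaquetteMatrix L *ᵥ x := by
  funext w
  rw [plaquetteMatrix_mulVec]

/-- The star syndrome of a dual chain at `s` is the plaquette syndrome at `-s`. [cite: DennisEtAl2002, §3.1] -/
theorem starMatrix_mulVec_dualChain [NeZero L] (x : Chain L) (s : Vertex L) :
    (starMatrix L *ᵥ dualChain x) s = (plaquetteMatrix L *ᵥ x) (-s) := by
  rw [plaquetteMatrix_mulVec, neg_neg]

/-- The conjugate decoder on the dual data: `dualErasureDecoder DX Er^* (∂ x^*) = (DX Er (H^Z x))^*`.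
[cite: DennisEtAl2002, §4.1] -/
theorem dualErasureDecoder_apply [NeZero L] (DX : ErasureDecoder (Edge L) (Vertex L → ZMod 2))
    (Er : Finset (Edge L)) (x : Chain L) :
    dualErasureDecoder DX (Er.map (dualEdge L).toEmbedding) (starMatrix L *ᵥ dualChain x) =
      dualChain (DX Er (plaquetteMatrix L *ᵥ x)) := by
  simp only [dualErasureDecoder, map_dualEdge_map_dualEdge, starMatrix_mulVec_dualChain_neg]

/-- **Failure events correspond**: the conjugate decoder fails on `(Er^*, x^*)` in the `Z` sector iff `DX` fails on
`(Er, x)` in the `X` sector. [cite: DennisEtAl2002, §4.3 (success iff the residual is homologically trivial, on either lattice)] -/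
theorem not_corrects_dualErasureDecoder_iff [NeZero L] (DX : ErasureDecoder (Edge L) (Vertex L → ZMod 2))
    (Er : Finset (Edge L)) (x : Chain L) :
    ¬ (dualErasureDecoder DX).Corrects (fun e => starMatrix L *ᵥ e) (boundaries L)
        (Er.map (dualEdge L).toEmbedding) (dualChain x) ↔
      ¬ DX.Corrects (fun e => plaquetteMatrix L *ᵥ e) (rowSpace (starMatrix L) : Set (Chain L)) Er x := by
  rw [not_iff_not]
  unfold ErasureDecoder.Corrects
  rw [dualErasureDecoder_apply, ← dualChain_add, dualChain_mem_boundaries_iff]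

/-- **Minimum weight outside the losses is preserved by conjugation**: if `DX` is a minimum-weight-outside-the-losses decoder
for the plaquette checks, `dualErasureDecoder DX` is one for the star checks.
[cite: DennisEtAl2002, §5.1 (E_min on the lattice and on the dual lattice)] -/
theorem isMinWeightOutside_dualErasureDecoder [NeZero L] {DX : ErasureDecoder (Edge L) (Vertex L → ZMod 2)}
    (hDX : DX.IsMinWeightOutside (plaquetteMatrix L)) :
    (dualErasureDecoder DX).IsMinWeightOutside (starMatrix L) := by
  intro Er e
  -- write `e = x^*`, `Er = Er₀^*`
  set x : Chain L := dualChain e with hx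
  set Er₀ : Finset (Edge L) := Er.map (dualEdge L).toEmbedding with hEr₀
  have he : e = dualChain x := by rw [hx, dualChain_dualChain]
  have hEr : Er = Er₀.map (dualEdge L).toEmbedding := by rw [hEr₀, map_dualEdge_map_dualEdge]
  obtain ⟨h1, h2⟩ := hDX Er₀ x
  rw [he, hEr, dualErasureDecoder_apply]
  refine ⟨?_, fun x' hx' => ?_⟩
  · funext s
    rw [starMatrix_mulVec_dualChain, starMatrix_mulVec_dualChain, h1]
  · have hsyn : plaquetteMatrix L *ᵥ dualChain x' = plaquetteMatrix L *ᵥ x := by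
      funext w
      rw [plaquetteMatrix_mulVec, dualChain_dualChain, hx', starMatrix_mulVec_dualChain, neg_neg]
    have h := h2 (dualChain x') hsyn
    rw [supp_dualChain_sdiff, Finset.card_map]
    have e2 : supp x' \ Er₀.map (dualEdge L).toEmbedding = (supp (dualChain x') \ Er₀).map (dualEdge L).toEmbedding := by
      conv_lhs => rw [← dualChain_dualChain x']
      exact supp_dualChain_sdiff _ _
    rw [e2, Finset.card_map]
    exact h

/-! ### The mixed-channel failure probability is self-dual -/

open Classical in
/-- **The `X`-sector loss–error failure probability IS a `Z`-sector one**: for every erasure-aware `X`-decoder `DX` of the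
`L × L` toric code and all rates `y, p`,
`mixedFailureProb H^Z (rs H^X) DX y p = mixedFailureProb H^X (boundaries) (dualErasureDecoder DX) y p`
(reindex losses and faults by the duality `dualEdge`; weights are preserved, failure events correspond).
[cite: DennisEtAl2002, §4.1 ("we may treat X errors and Z errors separately" — and identically, by duality)] [cite: StaceBarrettDoherty2009, p. 2] -/
theorem mixedFailureProb_dual [NeZero L] (DX : ErasureDecoder (Edge L) (Vertex L → ZMod 2)) (y p : ℝ) :
    mixedFailureProb (plaquetteMatrix L) (rowSpace (starMatrix L) : Set (Chain L)) DX y p =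
      mixedFailureProb (starMatrix L) (boundaries L) (dualErasureDecoder DX) y p := by
  set φ : Finset (Edge L) ≃ Finset (Edge L) := (dualEdge L).finsetCongr with hφ
  have hφ_apply : ∀ S : Finset (Edge L), φ S = S.map (dualEdge L).toEmbedding := fun S =>
    Equiv.finsetCongr_apply _ _
  have hw : ∀ (q : ℝ) (S : Finset (Edge L)), bernoulliWeight q (φ S) = bernoulliWeight q S := by
    intro q S
    unfold bernoulliWeight
    rw [hφ_apply, Finset.card_map]
  -- the failure predicates correspond under `φ × φ`
  have hpred : ∀ Er E : Finset (Edge L),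
      (∃ e : Chain L, supp e \ φ Er = φ E \ φ Er ∧
        ¬ (dualErasureDecoder DX).Corrects (fun e => starMatrix L *ᵥ e) (boundaries L) (φ Er) e) ↔
      (∃ x : Chain L, supp x \ Er = E \ Er ∧
        ¬ DX.Corrects (fun e => plaquetteMatrix L *ᵥ e) (rowSpace (starMatrix L) : Set (Chain L)) Er x) := by
    intro Er E
    rw [hφ_apply, hφ_apply]
    constructor
    · rintro ⟨e, heE, hfail⟩
      refine ⟨dualChain e, ?_, ?_⟩
      · have h1 : supp e \ Er.map (dualEdge L).toEmbedding =
            (supp (dualChain e) \ Er).map (dualEdge L).toEmbedding := by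
          conv_lhs => rw [← dualChain_dualChain e]
          exact supp_dualChain_sdiff _ _
        rw [h1, ← Finset.map_sdiff, Finset.map_inj] at heE
        exact heE
      · rw [← not_corrects_dualErasureDecoder_iff, dualChain_dualChain]
        exact hfail
    · rintro ⟨x, hxE, hfail⟩
      refine ⟨dualChain x, ?_, ?_⟩
      · rw [supp_dualChain_sdiff, ← Finset.map_sdiff, Finset.map_inj]
        exact hxE
      · rw [not_corrects_dualErasureDecoder_iff]
        exact hfail
  simp only [mixedFailureProb, Finset.sum_filter]
  symm
  rw [← φ.sum_comp]
  refine Fintype.sum_congr _ _ fun Er => ?_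
  rw [hw]
  refine congrArg (HMul.hMul (bernoulliWeight y Er)) ?_
  rw [← φ.sum_comp]
  refine Fintype.sum_congr _ _ fun E => ?_
  rw [hw]
  by_cases h : ∃ x : Chain L, supp x \ Er = E \ Er ∧
      ¬ DX.Corrects (fun e => plaquetteMatrix L *ᵥ e) (rowSpace (starMatrix L) : Set (Chain L)) Er x
  · rw [if_pos ((hpred Er E).2 h), if_pos h]
  · rw [if_neg (fun h' => h ((hpred Er E).1 h')), if_neg h]

/-! ### The `X`-sector phase boundary -/

/-- The `X`-sector loss–error family of a family of `X`-decoders is the `Z`-sector family of the conjugate decoders.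
[cite: DennisEtAl2002, §4.1] -/
theorem xMixedFamily_eq_mixedFamily_dual (DX : (L : ℕ) → ErasureDecoder (Edge (L + 1)) (Vertex (L + 1) → ZMod 2))
    (y : ℝ) :
    (fun L p => mixedFailureProb (plaquetteMatrix (L + 1)) (rowSpace (starMatrix (L + 1)) : Set (Chain (L + 1)))
        (DX L) y p) = mixedFamily (fun L => dualErasureDecoder (DX L)) y := by
  funext L p
  exact mixedFailureProb_dual (DX L) y p

/-- ★ **`X`-SECTOR PHASE BOUNDARY**: for `0 ≤ y ≤ 1` and every family of minimum-weight-outside-the-losses `X`-decoders of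
the toric codes (bit flips of rate `p` detected by the plaquettes, heralded losses of rate `y`), the error accuracy threshold
is positive iff `y < 1/2` — exactly as in the `Z` sector. [cite: StaceBarrettDoherty2009, p. 1 (abstract) and Fig. 2] [cite: DennisEtAl2002, §4.1] -/
theorem xMixed_accuracyThreshold_pos_iff (DX : (L : ℕ) → ErasureDecoder (Edge (L + 1)) (Vertex (L + 1) → ZMod 2))
    (hDX : ∀ L, (DX L).IsMinWeightOutside (plaquetteMatrix (L + 1))) {y : ℝ} (hy0 : 0 ≤ y) (hy1 : y ≤ 1) :
    0 < accuracyThreshold (fun L p => mixedFailureProb (plaquetteMatrix (L + 1))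
        (rowSpace (starMatrix (L + 1)) : Set (Chain (L + 1))) (DX L) y p) ↔ y < 1 / 2 := by
  rw [xMixedFamily_eq_mixedFamily_dual]
  exact mixed_accuracyThreshold_pos_iff _ (fun L => isMinWeightOutside_dualErasureDecoder (hDX L)) hy0 hy1

/-- **`X`-sector: exponential decay below a positive error rate, for every loss rate below `1/2`** (uniformly over the
minimum-weight-outside-the-losses `X`-decoder families). [cite: StaceBarrettDoherty2009, p. 3 and Fig. 2] [cite: KestenCMP1980, Thm. 2 (1.7)] -/
theorem xMixedFamily_decaysExponentially {y : ℝ} (hy0 : 0 ≤ y) (hy : y < 1 / 2) :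
    ∃ p₀ : ℝ, 0 < p₀ ∧ ∀ (DX : (L : ℕ) → ErasureDecoder (Edge (L + 1)) (Vertex (L + 1) → ZMod 2)),
      (∀ L, (DX L).IsMinWeightOutside (plaquetteMatrix (L + 1))) →
        ∀ p : ℝ, 0 ≤ p → p ≤ p₀ → DecaysExponentially (fun L p => mixedFailureProb (plaquetteMatrix (L + 1))
          (rowSpace (starMatrix (L + 1)) : Set (Chain (L + 1))) (DX L) y p) p := by
  obtain ⟨p₀, hp₀, h⟩ := mixedFamily_decaysExponentially hy0 hy
  refine ⟨p₀, hp₀, fun DX hDX p hp0 hp => ?_⟩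
  rw [xMixedFamily_eq_mixedFamily_dual]
  exact h _ (fun L => isMinWeightOutside_dualErasureDecoder (hDX L)) p hp0 hp

/-- **`X`-sector: beyond loss rate `1/2` no error rate is tolerable**, for ANY erasure-aware `X`-decoder family.
[cite: StaceBarrettDoherty2009, p. 2–3 and Fig. 2] -/
theorem xMixed_accuracyThreshold_eq_zero (DX : (L : ℕ) → ErasureDecoder (Edge (L + 1)) (Vertex (L + 1) → ZMod 2))
    {y : ℝ} (hy : 1 / 2 ≤ y) (hy1 : y ≤ 1) :
    accuracyThreshold (fun L p => mixedFailureProb (plaquetteMatrix (L + 1))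
        (rowSpace (starMatrix (L + 1)) : Set (Chain (L + 1))) (DX L) y p) = 0 := by
  rw [xMixedFamily_eq_mixedFamily_dual]
  exact mixed_accuracyThreshold_eq_zero _ hy hy1

/-- **Non-vacuity**: the canonical minimum-weight-outside-the-losses `X`-decoders qualify.
[cite: DumerKovalevPryadko2015, p. 3 (exhaustive search decoder)] -/
theorem minWeightOutside_xMixed_accuracyThreshold_pos {y : ℝ} (hy0 : 0 ≤ y) (hy : y < 1 / 2) :
    0 < accuracyThreshold (fun L p => mixedFailureProb (plaquetteMatrix (L + 1))
        (rowSpace (starMatrix (L + 1)) : Set (Chain (L + 1)))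
        (ErasureDecoder.minWeightOutside (plaquetteMatrix (L + 1))) y p) :=
  (xMixed_accuracyThreshold_pos_iff _ (fun L => ErasureDecoder.minWeightOutside_isMinWeightOutside _) hy0
    (by linarith)).2 hy

end ToricCode

end Literature.InformationTheory.QuantumCodes
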